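import Literature.Probability.RandomPlanarGeometry.HexSAWSurfaceFugacity
import Literature.Probability.RandomPlanarGeometry.HexSAWStripWidthOne
import HarnessLib

/-!
# The first strip threshold is exact: `y_1 = 2 + √2 = x_c⁻²`

Topic `Literature/Probability/RandomPlanarGeometry` (continues `HexSAWStripWidthOne.lean` — the classification of the `β`-walks of
the width-one strip `S_{1,L}` as the zig-zag walks `HV.zigWalk s k`, `s = ±1`, `1 ≤ k ≤ L + 1`, `HV.stripB_one_eq` — and the
capstone `HexSAWSurfaceFugacity.lean`: the strip thresholds `HV.stripYT T = sup {y ≥ 0 : L ↦ B_{T,L}(x_c; y) bounded}` (= BBdGDCG's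
`y_T`), `yStar_le_stripYT`, `stripBddSet_le` (`y_T ≤ 2 + √2`, from `HexSAWStripSurfaceZigzag`), `tendsto_stripYT_yStar`).
Source: N. R. Beaton, M. Bousquet-Mélou, J. de Gier, H. Duminil-Copin, A. J. Guttmann, CMP 326 (2014), arXiv:1109.0358v5, §3.2
Corollary 8 (p. 12: `y_T`, "y_T decreases to the critical fugacity y_c") and the proof of Proposition 5 (p. 9: the zig-zag walks).

## What is proved (HOME build of a-p2 g8, 2026-08-23; lane rung «T = 1 EXACT THRESHOLD», the kernel form of the lane's data face
## (a-ref-1 g40: at `T = 1` the threshold is exactly `1/x_c² = 2 + √2`); not stated in print — lane corollary, XS)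

* `surfContacts_one_zigWalk` — the zig-zag walk with `2k` inner vertices has exactly `k` surface contacts (the odd positions);
* **`stripGFy_beta_one_eq`** — `B_{1,L}(x_c; y) = 2 Σ_{k=1}^{L+1} (x_c² y)^k`;
* `stripGFy_beta_one_bddAbove` (`0 ≤ y < 2 + √2` ⇒ bounded by the geometric series) and the tree's `stripGFy_beta_not_bddAbove`
  (`y > 2 + √2` ⇒ unbounded) on either side;
* **`stripYT_one : stripYT 1 = 2 + √2`** — the first of BBdGDCG's strip thresholds is exactly `x_c⁻² = 2 + √2`: the upper bound
  `y_T ≤ 2 + √2` of the capstone is ATTAINED at `T = 1` (and `y_T ↓ 1 + √2`, `tendsto_stripYT_yStar`).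

STATUS IN PRINT (lit-1 g13, 2026-08-23; label NEW-IN-WRITING, XS, one line from print): the sentence `y_1 = 2 + √2` is not stated in
print; it is implicit in BBdGDCG14 Corollary 8 (arXiv v5 p. 12: the series A_T, B_T, C_T share the radius y_T) together with the exact
width-0 (= `T = 1` here; BGJ count widths from 0) arch series printed "by inspection" in
[cite: BeatonGuttmannJensen2012Adsorption, §1 (arXiv:1110.6695 p. 4: "A_0(x, y) = 2x³y/(1 − x²y)", denominator printed "1 − x²" sic; "gives y = y_c = 1 + √2")];
the `y = 1` case `B_0(z) = 2z²/(1 − z²)` is [cite: BeatonGuttmannJensen2012, §2 (p. 4)] = tree `HV.BGJ12.tendsto_stripB_one_B0`.  The proof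
below is the direct bridge-side one (`B_{1,L} = 2 Σ_{k=1}^{L+1} (x_c² y)^k`, bounded iff `y < 2 + √2`) and uses neither.
-/

noncomputable section

open Finset Filter Topology

namespace Literature.Probability.RandomPlanarGeometry.SAW.HV

/-- Among the positions `0, s, 2s, …, (2k−1)s` (`s = ±1`) exactly `k` are odd. [folklore] -/
private theorem length_filter_odd_range (s : ℤ) (hs : s = 1 ∨ s = -1) (k : ℕ) :
    ((List.range (2 * k)).filter fun i : ℕ => s * (i : ℤ) % 2 = 1).length = k := by
  induction k with
  | zero => simp
  | succ k ih =>
    have e : 2 * (k + 1) = (2 * k + 1) + 1 := by ring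
    rw [e, List.range_succ, List.range_succ, List.filter_append, List.filter_append, List.length_append,
      List.length_append, ih, List.filter_singleton, List.filter_singleton]
    have h0 : decide (s * ((2 * k : ℕ) : ℤ) % 2 = 1) = false := by
      rw [decide_eq_false_iff_not]; rcases hs with rfl | rfl <;> push_cast <;> omega
    have h1 : decide (s * ((2 * k + 1 : ℕ) : ℤ) % 2 = 1) = true := by
      rw [decide_eq_true_iff]; rcases hs with rfl | rfl <;> push_cast <;> omega
    rw [h0, h1]
    simp

/-- **The zig-zag walk with `2k` inner vertices has `k` surface contacts** (`T = 1`: the surface is the level `1` = the down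
triangles = the odd positions of the width-one path). [cite: BeatonBousquetMelouDeGierDuminilCopinGuttmann2014, proof of Proposition 5 (arXiv v5 p. 9: "zig-zag walks sticking to the surface")] -/
theorem surfContacts_one_zigWalk {s : ℤ} (hs : s = 1 ∨ s = -1) (k : ℕ) : surfContacts 1 (zigWalk s k) = k := by
  rw [zigWalk, surfContacts_cons_append, zigInner, List.filter_map, List.length_map]
  have : ((List.range (2 * k)).filter ((fun v => decide (lev v = 2 * ((1 : ℕ) : ℤ) - 1)) ∘ fun i : ℕ => vtx (s * (i : ℤ)))) =
      (List.range (2 * k)).filter fun i : ℕ => s * (i : ℤ) % 2 = 1 := by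
    refine List.filter_congr fun i _ => ?_
    simp only [Function.comp, lev, vtx_snd, bit_vtx, mul_zero, zero_add, Nat.cast_one, decide_eq_decide]
    norm_num
  rw [this, length_filter_odd_range s hs k]

/-- **`B_{1,L}(x_c; y) = 2 Σ_{k=1}^{L+1} (x_c² y)^k`**: two zig-zag bridges of each even length `2k`, each with `k` contacts.
[cite: BeatonBousquetMelouDeGierDuminilCopinGuttmann2014, §3.2 (B_T(x,y)) with the proof of Proposition 5 (arXiv v5 p. 9); lane: exact width-one count] -/
theorem stripGFy_beta_one_eq (L : ℕ) (y : ℝ) :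
    stripGFy 1 L (IsBetaDart 1) y = 2 * ∑ k ∈ Icc 1 (L + 1), (hexCriticalFugacity ^ 2 * y) ^ k := by
  rw [stripGFy, filter_isBetaDart_one_eq_image, sum_image (zigWalk_injOn L), sum_product,
    sum_pair (by norm_num : (1 : ℤ) ≠ -1)]
  simp only [mwLen_zigWalk, surfContacts_one_zigWalk (Or.inl rfl), surfContacts_one_zigWalk (Or.inr rfl), mul_pow, ← pow_mul]
  ring

/-- For `0 ≤ y` with `x_c² y < 1` the width-one bridge class is bounded in `L`: `B_{1,L}(x_c; y) ≤ 2 x_c² y/(1 − x_c² y)`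
(geometric series). [cite: BeatonBousquetMelouDeGierDuminilCopinGuttmann2014, Corollary 8 (arXiv v5 p. 12: y_T); lane: T = 1] -/
theorem stripGFy_beta_one_le {y : ℝ} (hy : 0 ≤ y) (hq : hexCriticalFugacity ^ 2 * y < 1) (L : ℕ) :
    stripGFy 1 L (IsBetaDart 1) y ≤ 2 * ((hexCriticalFugacity ^ 2 * y) / (1 - hexCriticalFugacity ^ 2 * y)) := by
  set q := hexCriticalFugacity ^ 2 * y with hqdef
  have hq0 : 0 ≤ q := by positivity
  rw [stripGFy_beta_one_eq]
  refine mul_le_mul_of_nonneg_left ?_ (by norm_num)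
  have hI : Icc 1 (L + 1) = Ico 1 (L + 2) := by
    ext k; simp only [mem_Icc, mem_Ico]; omega
  rw [hI]
  have h := geom_sum_Ico_le_of_lt_one hq0 hq (m := 1) (n := L + 2)
  rwa [pow_one] at h

/-- … hence bounded in `L`. [cite: BeatonBousquetMelouDeGierDuminilCopinGuttmann2014, Corollary 8 (arXiv v5 p. 12: y_T); lane: T = 1] -/
theorem stripGFy_beta_one_bddAbove {y : ℝ} (hy : 0 ≤ y) (hlt : y < 2 + Real.sqrt 2) :
    BddAbove (Set.range fun L : ℕ => stripGFy 1 L (IsBetaDart 1) y) := by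
  have hsq := hexCriticalFugacity_sq
  have hx2 : 0 < hexCriticalFugacity ^ 2 := by have := hexCriticalFugacity_pos_lt_one.1; positivity
  have hq : hexCriticalFugacity ^ 2 * y < 1 := by nlinarith
  exact ⟨_, by rintro _ ⟨L, rfl⟩; exact stripGFy_beta_one_le hy hq L⟩

/-- **`y_1 = 2 + √2` exactly**: the first strip threshold of BBdGDCG (the lane's `stripYT 1`, = sup of the boundedness set) equals
`x_c⁻² = 2 + √2` — the upper bound `stripBddSet_le` of the capstone is attained at `T = 1`.
[cite: BeatonBousquetMelouDeGierDuminilCopinGuttmann2014, Corollary 8 (arXiv v5 p. 12: "y_T decreases to the critical fugacity y_c"); lane corollary: the first term of that sequence, not stated in print] -/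
theorem stripYT_one : stripYT 1 = 2 + Real.sqrt 2 := by
  have h1 : (1 : ℕ) ≤ 1 := le_rfl
  refine le_antisymm ?_ ?_
  · -- every member of the boundedness set is `≤ 2 + √2`
    have hy1 : (1 : ℝ) < yStar := by
      unfold yStar; linarith [Real.sqrt_pos.2 (show (0 : ℝ) < 2 by norm_num)]
    exact csSup_le ⟨1, mem_stripBddSet_of_lt h1 one_pos hy1⟩ fun y hy => stripBddSet_le h1 hy
  · -- every `0 ≤ y < 2 + √2` is in the set
    refine le_of_forall_lt_imp_le_of_dense fun y hy => ?_
    rcases lt_or_ge y 0 with hneg | hnn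
    · have : (0 : ℝ) ≤ stripYT 1 := le_stripYT h1 le_rfl (stripGFy_beta_one_bddAbove le_rfl (by positivity))
      linarith
    · exact le_stripYT h1 hnn (stripGFy_beta_one_bddAbove hnn hy)

end Literature.Probability.RandomPlanarGeometry.SAW.HV
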